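import Summits.QuantumFields.BalabanUV.T4Continuum.Support.NE9CurChartTowerPiUniformBall
import Literature.MathematicalPhysics.QuantumFieldTheory.Balaban1983to89.B11Eq117ChartLettersOnModel

/-!
# NE9CurChartTowerPiLatticeUniform — THE CHART OF THE CURVE SPECIES `cur U` FOR PRINT's `k`-TH-STEP OPERATOR (3.122) ON ONE AND THE SAME BALL FOR
# EVERY HEIGHT `k = n+1`, EVERY SPACING ON THE DIAGONAL, EVERY PERIOD `m` AND EVERY BACKGROUND OF THE CELL's MODEL BLOCK: the radii `ε₄ ε_C R_b R′`
# (and the windows `α₁`, `j₁`) are chosen BEFORE `∀ n η m U` — `Support/NE9CurChartTowerPiUniformBall` (ne9-leaf-03 g68: radii before `∀ U` but AFTER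
# the lattice, through (117)'s displayed products `√(c₀·#bonds)`, `2|η|⁻¹`) with its two lattice-dependent inputs REPLACED by the CLOSED (117) ∕ (103)
# sockets of the sup-norm programme (`B11Eq117ChartLettersOnModel.exists_norm_chartLetters_le`: X12 `B9Eq3152StoreyHClosedOnModel` + (I-1)
# `B9Eq347H1kPiSupGradGlobal` through the carrier bridge `B11Eq117ReadLettersBridge`); cell `pub-balaban`, T4-DAG §2 node U3 ∕ §6 NE9, route R2′
# (instance-ledger row L12 «the Δ_π port G₀ ↦ G̃»; WALL-NE9-P1 v1.14.20 «the k-level chart's residual non-uniformity is (117)'s displayed product ONLY»);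
# NE9 crux-team (2) leaf prover 01 (`b2b-balaban-t4-ne9-formalise-leaf-01`, gen 96); Summits-side NEW leaf under this seat's INTERFACE REQUEST NE9
# [NE9LEAF01-G96-IFR] (HOME/INBOX.md; ruling e34b3e0c (0) «no new leaves unless a CRUX prover requests a specific NAMED interface»); nothing printed asserted

HONEST FRAMING (T4-DAG PAGE 1).  Rung (B)+1 of the FINITE-VOLUME T⁴ programme — NOT infinite volume, NOT a mass gap, NOT the Clay problem.  NE9 is a
cell NEW ESTIMATE, NOT PRINTED in [Balaban1987RG1] ∕ [Balaban1988RG2Cluster], and NOT PROVED here («NE9 ⇐ the named binders»; spine PROVED 0∕9).  HONEST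
DEPENDENCY (cell line, verbatim): continuum YM on T⁴ ⇐ BetaPertH ∧ nine spine estimates (0/9 proved); BetaPertH ⇐ (D1) ∧ (D4) ∧ CAP+tail; G-an2-4
gates asym, D1 and NE2/3/4.  The `cur U` OBJECT is ONE item of the MODEL O-NE9-1 (species (a) data); `act` ∕ `ker` and NEEDS-COORDINATOR #5 untouched.

WHY THIS FILE.  In `NE9CurChartTowerPiUniformBall.cur_chart_exists_tower_pi_of_small_field_unitary_uniform` the radii are functions of the two operator norms
`‖𝔊̃_k‖ ≤ C·V_G`, `‖H̃_{1,k}‖ ≤ C·V_H` supplied by `B9Eq3126EnergyBallTowerPiCLM` — `L²`∕energy bounds read in the sup type at the price of the coarse ∕ fine bond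
counts and of `M_∇ = 2|η|⁻¹`: finite-lattice numbers, exponential in `k`.  The NE9 owner's sup-norm programme (PLAN v10 ff.: [Balaban1985BackgroundPropagators] Thm 3.1
(3.42)⟹(3.47), Thm 3.13 ∕ [Balaban1985Variational] (117) as block sup → sup rows with exponential decay) and this lineage's STOREYS (the middle word, STOREY H = the
covariant Hessian row by the commutator route, (3.36) entering) closed the (117) socket for the FULL `𝔊̃_k` with ONE height-free constant (X12), and (I-1)–(I-4) of this
generation did the same for `H̃_{1,k}` and moved both into the chart's own currency.  This file feeds them to the unchanged scalar plumbing
(`B11Eq118RegimeScalars.exists_twoRegimes_radii_of_bounds`, `B11Eq44CLetterTower.quadAnalytic_Cck` ∕ `analyticOnNhd_Cck`, `NE9B11ChartAnalytic.chartHB_triple_of_twoRegimes`).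

WHAT THIS FILE PROVES (ONE theorem; 0 def, 0 sorry, axioms standard).  **`cur_chart_exists_tower_pi_lattice_uniform`** — for fixed `L`, the fibre ∕ trace letters
`φ, M_φ, M_φ′, τ, …`, print's parameters `a, a′ > 0`, the level-profile room `(ϱ, AQ, ρ_w)`, `C_k`'s numerics (an averaging-closed gauge class `G ≤ U1` with `α₀`, `ρ`), the
(L3) constants `(C₄, a₃)` and two numbers `ω, Ω ≥ 0` bounding the (115) weight profile: `∃ α₁ j₁ ε₄ ε_C R_b R′` (`α₁, j₁, R_b, R′ > 0`) BEFORE `∀`, such that for EVERY height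
`n`, spacing `η` on the diagonal (`ηL^{n+1} = 1`, weights `c₀L^{(n+1)d} = c₁`, `c₀ = η^d`, `|η|^d∕c₀ ≤ ρ_w`), period `m`, background `U` with the MODEL block's data VERBATIM
(the block of X12 ∕ G-3 ∕ (K86) through `hQ`: per-level `U1`∕regularity profile `αU` with `Σ αU ≤ AQ`, bond deviations `εU ≤ αϱ^j`, unitarity, print's windows `‖U(b) − 1‖ ≤ αη`,
`‖U(∂p) − 1‖ ≤ αη²`, `‖U(x,μ) − U(x−e_μ,μ)‖ ≤ αη²`, the current window `‖J‖ ≤ j₀ ≤ j₁` ((3.36)), ANY positivity witnesses `hpos′ hpos hposπ` and right-inverse witness `hQ`),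
`Ũ ∈ G`, level maps with `n+1 ≤ lev₀`, weight profile `w̄₀, w̄₁ ≤ ω`, `w̲₃⁻¹, w̲_B⁻¹ ≤ Ω`, and every admissible (L3) slot `Wq`: the triple (Ψ1) `DifferentiableOn ℂ` on `ball 0 R_b`,
(Ψ2) `MapsTo (ball 0 R_b) (ball 0 R′)`, (Ψ3) value `0` at `0` for `chartHB 𝔊̃_k 0 Wq 0 (A′ ↦ A′ + solA H̃_{1,k} 0 C_k 0 ε_C A′) ε₄ H̃_{1,k}` with
`𝔊̃_k := frakGLatticeCLM φ hposπ hQ lev₁ (nabla115 η U)`, `H̃_{1,k} := H1LatticeCLM φ hposπ hQ lev₁ (nabla115 η U)`, `C_k := Cck L m η (n+1) U lev₀ lev₁ (nabla115 η U) levB`.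
PROOF: `exists_norm_chartLetters_le` ∃-first; `C_G = C_H := ω·M_φBM_φ′·Ω` before `∀`; the regimes' scalars from these bounds; per lattice (52) from the plaquette window
(`pdev_perCfg_le_of_plaq`, `α ≤ α₀∕2`), `C_k`'s letters, the two operator norms at this lattice, composition by `chartHB_triple_of_twoRegimes` — verbatim the host's last lines.
DISGUISE TEST: composition by name of landed theorems; no inequality of the series proved HERE (the rows behind X12 ∕ (I-1) are the tree's kernel-checked sup → sup estimates on
the MODEL, constants crude and symbolic, NOT print's `B₀`); the per-level profile `αU` with `Σ αU ≤ AQ`, the positivity ∕ surjectivity witnesses, the weight-profile bounds and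
the (L3) `W` stay DISPLAYED; NOT the gauge step of p. 416, NOT the two-background chart, NOT claimed that Bałaban's 𝐇_k ∕ U_j(□₀, exp iB) meet these letters (O-NE9-1; #5
UNRULED); not NE9.  What IS new relative to the host: NO radius depends on the height, the spacing or the period.
References (TYPES ∕ loci only): [Balaban1985Variational] (44)–(47) p. 285, (103) p. 293, Prop. 6 (117)–(121) p. 295, (172)–(175) p. 305; [Balaban1985BackgroundPropagators]
(3.35)–(3.37) p. 396, Thm 3.1 (3.42)∕(3.47) pp. 397–398, Thm 3.11 p. 416, (3.122)–(3.126) p. 420, Thm 3.12 p. 423, (3.153) p. 426, Thm 3.13 p. 426; [Balaban1985Averaging] Prop. 2 (52)–(54) p. 26.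
-/

noncomputable section

open Metric Set

namespace Summit.QuantumFields.BalabanUV.T4Continuum.NE9CurChartTowerPiLatticeUniform

open scoped InnerProductSpace ComplexConjugate BigOperators
open Literature.MathematicalPhysics.QuantumFieldTheory.Balaban1983to89
open B11Eq103H1Complex B11Eq115Space B11Eq174Chart
open B11Eq111FrakG (nabla115)
open B13Contraction113 (QuadAnalytic)
open B9SectCLatticeCarrier (Bond bpos btgt unshift)
open B4Sect5Torus (TSite)
open B7Prop1Explicit (U1 Wcx boxVec)
open B7Prop2Explicit (pdev AvgClosed C0 c2')
open B7Prop3Flat (c3)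
open B9Eq315QTorus (perCfg cornerSite)
open B9Eq315QTower (towerP UlevOf)
open B9Eq326OperatorTower (QkW laplaceAk)
open B9Eq310HessianOperator (adTransportW)
open B9Eq310DeltaPrime (plaqHolU)
open B9Eq324DeltaPrimeATower (laplacePrimeAk)
open B9Eq3119DeltaPiTower (laplaceAkPi)
open B11Eq118RegimeScalars (exists_twoRegimes_radii_of_bounds)
open B11Eq44COperatorTower (C2T C2T_nonneg)
open B11Eq44CLetterTower (Cck quadAnalytic_Cck analyticOnNhd_Cck)
open B7Eq43AveragedSmallnessLevelFree (pdev_perCfg_le_of_plaq)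
open B11Eq117ChartLettersOnModel (exists_norm_chartLetters_le)
open Summit.QuantumFields.BalabanUV.T4Continuum.NE9B11ChartAnalytic (chartHB_triple_of_twoRegimes)

variable {d : ℕ} (hd : 1 ≤ d) (L : ℕ) [NeZero L] (hL : 1 ≤ L) (hL2 : 2 ≤ L) (hL3 : 3 ≤ L) [Fact (0 < (L : ℝ))]
  {𝔸 : Type*} [NormedRing 𝔸] [NormedAlgebra ℂ 𝔸] [CompleteSpace 𝔸] [NormOneClass 𝔸] [StarRing 𝔸] [NormedStarGroup 𝔸] [StarModule ℂ 𝔸] [FiniteDimensional ℂ 𝔸]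
  {W : Type*} [NormedAddCommGroup W] [InnerProductSpace ℂ W] [FiniteDimensional ℂ W] (φ : W ≃ₗ[ℂ] 𝔸)
  {Mφ Mφ' : ℝ} (hMφ : 0 ≤ Mφ) (hMφ' : 0 ≤ Mφ') (hφ : ∀ w, ‖φ w‖ ≤ Mφ * ‖w‖) (hφ' : ∀ X, ‖φ.symm X‖ ≤ Mφ' * ‖X‖) (hstar : ∀ X : 𝔸, ‖star X‖ ≤ ‖X‖)
  {a : ℝ} (ha : 0 < a) {a' : ℝ} (ha' : 0 < a') {ϱ : ℝ} (hϱ0 : 0 ≤ ϱ) (hϱ1 : ϱ < 1)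
  (τ : 𝔸 →ₗ[ℂ] ℂ) {Cτ : ℝ} (hτ : ∀ X, ‖τ X‖ ≤ Cτ * ‖X‖) (hCτ : 0 ≤ Cτ) {Mτ : ℝ} (hτm : ∀ X Y : 𝔸, ‖τ (X * Y)‖ ≤ Mτ * ‖X‖ * ‖Y‖) (hMτ : 0 ≤ Mτ)
  {ρw : ℝ} (hρw : 0 ≤ ρw)
  (hτ₁ : ∀ X : 𝔸, τ (star X) = conj (τ X)) (hτ₂ : ∀ X Y : 𝔸, τ (X * Y) = τ (Y * X)) (hφτ : ∀ X Y : 𝔸, ⟪φ.symm X, φ.symm Y⟫_ℂ = τ (star X * Y))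
  (AQ : ℝ)
  {G : Subgroup 𝔸ˣ} (hG : AvgClosed d L G) {α₀ : ℝ} (hα₀ : 0 < α₀) (hα3 : C0 d * α₀ ≤ 1 / 3) (hα4 : 4 * α₀ ≤ c2' d L)
  {ρ : ℝ} (hρ0 : 0 < ρ) (hρ : Real.exp (4 * (800 * ((d : ℝ) + 1) ^ 2 * ((d : ℝ) + 4)) * α₀) * (1 + 8 * (131072 * ((d : ℝ) + 1) ^ 2) * ρ) ≤ 2)
  (hρc : 2 * ρ ≤ c3 d L) {C₄ a₃ : ℝ} (hC₄ : 0 ≤ C₄) (ha₃ : 0 < a₃) {ω Ω : ℝ} (hω : 0 ≤ ω) (hΩ : 0 ≤ Ω)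

-- deep definitional unfolding `laplaceAkPi` ↦ `laplaceALatticeK … (π†Δπ) …` in the statement (as the host)
set_option maxRecDepth 8192 in
set_option maxHeartbeats 800000 in -- the ≈ 50-binder block + the three-letter chart term (as X12 ∕ (I-4))
include hd hL hL2 hL3 hMφ hMφ' hφ hφ' hstar ha ha' hϱ0 hϱ1 hτ hCτ hτm hMτ hρw hτ₁ hτ₂ hφτ hG hα₀ hα3 hα4 hρ0 hρ hρc hC₄ ha₃ hω hΩ in
/-- **THE CHART OF `cur U` FOR PRINT's `k`-TH-STEP OPERATOR `Δ̃_{a,k}(U)` (3.122) ON ONE AND THE SAME BALL FOR EVERY HEIGHT, SPACING, PERIOD AND BACKGROUND OF THE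
MODEL BLOCK**: `∃ α₁ j₁ ε₄ ε_C R_b R′` BEFORE `∀ n η m U …`; per lattice only (52) (from the plaquette window, `α ≤ α₀∕2`), `C_k`'s letters, and the two CLOSED operator
norms `‖𝔊̃_k‖, ‖H̃_{1,k}‖ ≤ max(w̄₀, w̄₁)·M_φBM_φ′·w̲⁻¹ ≤ ω·M_φBM_φ′·Ω` (`exists_norm_chartLetters_le`); composition by `chartHB_triple_of_twoRegimes`. [folklore]
[cite: Balaban1985BackgroundPropagators, (3.122) p.420, (3.126) p.420, (3.153) p.426, Thm 3.12 p.423, Thm 3.13 p.426, Thm 3.1 (3.47) p.398, (3.35)–(3.37) p.396; Balaban1985Variational, (103) p.293, Prop. 6 (117)–(121) p.295, (172)–(175) p.305; Balaban1985Averaging, Prop. 2 (52)–(54) p.26] -/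
theorem cur_chart_exists_tower_pi_lattice_uniform :
    ∃ α₁ j₁ ε₄ εC Rb R' : ℝ, 0 < α₁ ∧ 0 < j₁ ∧ 0 < Rb ∧ 0 < R' ∧
      ∀ (n : ℕ) (η : ℝ) [Fact (0 < η)] (_hηL : η * (L : ℝ) ^ (n + 1) = 1) (c₀ c₁ : ℝ) [Fact (0 < c₀)] [Fact (0 < c₁)]
        (_hw : c₀ * ((L : ℝ) ^ (n + 1)) ^ d = c₁) (_hρ : |η| ^ d / c₀ ≤ ρw) (m : Fin d → ℕ) [∀ i, NeZero (m i)] (_hm : ∀ i, 1 ≤ m i)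
        (U : Bond d (towerP L m (n + 1)) → 𝔸ˣ) (αU : ℕ → ℝ) (_hα0 : ∀ j, 0 ≤ αU j) (hα1 : ∀ j, αU j ≤ 1 / 64)
        (hαL : ∀ j, 50 * (d + 1) * αU j * (L : ℝ) ^ d ≤ 1 / 2)
        (hU1 : ∀ (j : ℕ) (x : B7Prop1Explicit.Site d) (k : Fin d), perCfg (towerP L m (j + 1)) (UlevOf L m (n + 1) U j) x k ∈ U1 𝔸)
        (hreg : ∀ (j : ℕ) (y : TSite d (towerP L m j)) (k : Fin d) (ρ' : Fin d → Fin L),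
          ‖((Wcx L (perCfg (towerP L m (j + 1)) (UlevOf L m (n + 1) U j)) (cornerSite L y) k (boxVec L ρ') : 𝔸ˣ) : 𝔸) - 1‖ ≤ αU j)
        (εU : ℕ → ℝ) (_hεU : ∀ j, 0 ≤ εU j) (_hUε : ∀ (j : ℕ) (b : Bond d (towerP L m (j + 1))), ‖(UlevOf L m (n + 1) U j b : 𝔸) - 1‖ ≤ εU j)
        (_hLb : ∀ (j : ℕ) (b : Bond d (towerP L m (j + 1))), UlevOf L m (n + 1) U j b ∈ U1 𝔸)
        (α : ℝ) (_hα : 0 ≤ α) (_hαle : α ≤ α₁)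
        (hUst : ∀ b, star (U b : 𝔸) = (((U b)⁻¹ : 𝔸ˣ) : 𝔸)) (_hUb : ∀ b, U b ∈ U1 𝔸) (_hUη : ∀ b, ‖(U b : 𝔸) - 1‖ ≤ α * η)
        (_hpl : ∀ p : B9SectCLatticeCarrier.Plaq d (towerP L m (n + 1)), ‖(plaqHolU U p : 𝔸) - 1‖ ≤ α * η ^ 2)
        (_hUgrad : ∀ (x : TSite d (towerP L m (n + 1))) (μ : Fin d), ‖(U (x, μ) : 𝔸) - U (unshift μ x, μ)‖ ≤ α * η ^ 2)
        (_hRlev : ∀ (j : ℕ) (b : Bond d (towerP L m (j + 1))) (w : W), ‖adTransportW φ (UlevOf L m (n + 1) U j) b w‖ ≤ ‖w‖)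
        (_hεg : ∀ j < n + 1, εU j ≤ α * ϱ ^ j) (_hAQ : ∑ j ∈ Finset.range (n + 1), αU j ≤ AQ)
        (hpos' : ∀ x : SiteL2K ℂ d (towerP L m (n + 1)) c₀ W, x ≠ 0 → 0 < RCLike.re ⟪x, laplacePrimeAk L m n φ η U a' (c₁ := c₁) x⟫_ℂ)
        (hpos : ∀ x : BondL2K ℂ d (towerP L m (n + 1)) c₀ W, x ≠ 0 →
          0 < RCLike.re ⟪x, laplaceAk L m n φ η U hL αU hα1 hU1 hreg τ (c₀ := c₀) (c₁ := c₁) a x⟫_ℂ)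
        (_hc₀η : c₀ = η ^ d) (j₀ : ℝ) (_hJ : ∀ μ y, ‖B9Eq39Adjoint.J (fun μ => B9Eq33CovDerivVector.shiftEquiv μ) (fun μ y => U (y, μ)) η μ y‖ ≤ j₀) (_hj : j₀ ≤ j₁)
        (hposπ : ∀ x : BondL2K ℂ d (towerP L m (n + 1)) c₀ W, x ≠ 0 →
          0 < RCLike.re ⟪x, laplaceAkPi L m n φ τ η U a' hpos' hL αU hα1 hU1 hreg (c₁ := c₁) a x⟫_ℂ)
        (hQ : Function.Surjective (QkW L m n φ U hL αU hα1 hU1 hreg (c₀ := c₀) (c₁ := c₁)))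
        (_hUG : ∀ (x : B7Prop1Explicit.Site d) (κ : Fin d), perCfg (towerP L m (n + 1)) U x κ ∈ G)
        (lev₀ : Bond d (towerP L m (n + 1)) → ℕ) (lev₁ : Bond d (towerP L m (n + 1)) × Fin d → ℕ) (levB : Bond d m → ℕ) (_hlev : ∀ b, n + 1 ≤ lev₀ b)
        (_hw₀ : (NegSup.wSup (levWeight (L : ℝ) η lev₀ 1) : ℝ) ≤ ω) (_hw₁ : (NegSup.wSup (levWeight (L : ℝ) η lev₁ 2) : ℝ) ≤ ω)
        (_hw₃ : (NegSup.wInvSup (levWeight (L : ℝ) η lev₀ 3) : ℝ) ≤ Ω) (_hwB : (NegSup.wInvSup (levWeight (L : ℝ) η levB 0) : ℝ) ≤ Ω)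
        {Wq : Space115 (L : ℝ) η lev₀ lev₁ (nabla115 η U) → NegSize (L : ℝ) η lev₀ 3 𝔸}, QuadAnalytic Wq C₄ a₃ →
        AnalyticOnNhd ℂ Wq {Y | ‖Y‖ < a₃} →
        DifferentiableOn ℂ (chartHB (frakGLatticeCLM (lev₀ := lev₀) φ hposπ hQ lev₁ (nabla115 η U))
            0 Wq 0 (fun A' => A' + solA (H1LatticeCLM (lev₀ := lev₀) (levB := levB) φ hposπ hQ lev₁ (nabla115 η U)) 0
              (Cck L m η (n + 1) U lev₀ lev₁ (nabla115 η U) levB) 0 εC A') ε₄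
            (H1LatticeCLM (lev₀ := lev₀) (levB := levB) φ hposπ hQ lev₁ (nabla115 η U)))
          (ball (0 : NegSize (L : ℝ) η levB 0 𝔸) Rb) ∧
        MapsTo (chartHB (frakGLatticeCLM (lev₀ := lev₀) φ hposπ hQ lev₁ (nabla115 η U))
            0 Wq 0 (fun A' => A' + solA (H1LatticeCLM (lev₀ := lev₀) (levB := levB) φ hposπ hQ lev₁ (nabla115 η U)) 0
              (Cck L m η (n + 1) U lev₀ lev₁ (nabla115 η U) levB) 0 εC A') ε₄
            (H1LatticeCLM (lev₀ := lev₀) (levB := levB) φ hposπ hQ lev₁ (nabla115 η U)))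
          (ball (0 : NegSize (L : ℝ) η levB 0 𝔸) Rb) (ball (0 : Space115 (L : ℝ) η lev₀ lev₁ (nabla115 η U)) R') ∧
        chartHB (frakGLatticeCLM (lev₀ := lev₀) φ hposπ hQ lev₁ (nabla115 η U))
            0 Wq 0 (fun A' => A' + solA (H1LatticeCLM (lev₀ := lev₀) (levB := levB) φ hposπ hQ lev₁ (nabla115 η U)) 0
              (Cck L m η (n + 1) U lev₀ lev₁ (nabla115 η U) levB) 0 εC A') ε₄
            (H1LatticeCLM (lev₀ := lev₀) (levB := levB) φ hposπ hQ lev₁ (nabla115 η U)) 0 = 0 := by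
  -- the two chart letters, `∃`-first (height ∕ lattice ∕ background-free `B`)
  obtain ⟨α₁, j₁, B, hα₁, hj₁, hB, HL⟩ :=
    exists_norm_chartLetters_le hd L hL hL3 φ hMφ hMφ' hφ hφ' hstar ha ha' hϱ0 hϱ1 τ hτ hCτ hτm hMτ hρw hτ₁ hτ₂ hφτ AQ
  -- ONE majorant of both operator norms, before `∀`
  obtain ⟨CG, hCGdef⟩ : ∃ CG : ℝ, CG = ω * (Mφ * B * Mφ') * Ω := ⟨_, rfl⟩
  have hCG : 0 ≤ CG := by rw [hCGdef]; positivity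
  -- the scalar letters of the two regimes from the BOUNDS (`C_k`'s constants `C2T d α₀`, `ρ` are U-free)
  obtain ⟨j, a'', ε₄, aC, εC, R', Rb, hj, ha'', -, -, -, hR'0, hRb0, hcap, hR'le, Hreg⟩ :=
    exists_twoRegimes_radii_of_bounds (B₀ := CG) (b := CG) (b₁ := CG) (C₄ := C₄) (a₃ := a₃) (C₂ := C2T d α₀) (c₄ := ρ) hCG hCG hCG
      hC₄ ha₃ (C2T_nonneg d α₀) hρ0
  refine ⟨min α₁ (α₀ / 2), j₁, ε₄, εC, Rb, R', lt_min hα₁ (by positivity), hj₁, hRb0, hR'0, ?_⟩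
  intro n η _ hηL c₀ c₁ _ _ hw hρ' m _ hm U αU hα0 hα1 hαL hU1 hreg εU hεU hUε hLb α hα hαle hUst hUb hUη hpl hUgrad hRlev hεg hAQ hpos' hpos hc₀η j₀ hJ hj'
    hposπ hQ hUG lev₀ lev₁ levB hlev hw₀ hw₁ hw₃ hwB Wq hW hWa
  have hα1' : α ≤ α₁ := hαle.trans (min_le_left _ _)
  have hαh : α ≤ α₀ / 2 := hαle.trans (min_le_right _ _)
  -- (52) from the PLAQUETTE window: `pdev Ũ ≤ αη² < α₀η² = α₀L^{−2(n+1)}`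
  have hη : ((L : ℝ) ^ (n + 1))⁻¹ = η := inv_eq_of_mul_eq_one_left hηL
  have h52 : pdev (perCfg (towerP L m (n + 1)) U) < α₀ * (((L : ℝ) ^ (n + 1))⁻¹) ^ 2 := by
    have hp := pdev_perCfg_le_of_plaq (U := U) hUb (by positivity) hpl
    rw [hη]
    have hη0 : 0 < η := Fact.out
    exact lt_of_le_of_lt hp (mul_lt_mul_of_pos_right (by linarith) (by positivity))
  -- the two operator norms at this lattice, against the ONE majorant `CG`
  obtain ⟨hGb, hHb⟩ := HL n η hηL c₀ c₁ hw hρ' m hm U αU hα0 hα1 hαL hU1 hreg εU hεU hUε hLb α hα hα1' hUst hUb hUη hpl hUgrad hRlev hεg hAQ hpos' hpos hc₀η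
    j₀ hJ hj' hposπ hQ (L : ℝ) η lev₀ lev₁ levB
  have hMB : 0 ≤ Mφ * B * Mφ' := by positivity
  have hmax : max ((NegSup.wSup (levWeight (L : ℝ) η lev₀ 1) : ℝ) * (Mφ * B * Mφ')) (NegSup.wSup (levWeight (L : ℝ) η lev₁ 2) * (Mφ * B * Mφ')) ≤
      ω * (Mφ * B * Mφ') :=
    max_le (mul_le_mul_of_nonneg_right hw₀ hMB) (mul_le_mul_of_nonneg_right hw₁ hMB)
  have hmax0 : 0 ≤ max ((NegSup.wSup (levWeight (L : ℝ) η lev₀ 1) : ℝ) * (Mφ * B * Mφ')) (NegSup.wSup (levWeight (L : ℝ) η lev₁ 2) * (Mφ * B * Mφ')) :=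
    le_max_of_le_left (mul_nonneg (NegSup.wSup (levWeight (L : ℝ) η lev₀ 1)).coe_nonneg hMB)
  have hGb' : ‖frakGLatticeCLM (L := (L : ℝ)) (η := η) (lev₀ := lev₀) φ hposπ hQ lev₁ (nabla115 η U)‖ ≤ CG := by
    rw [hCGdef]
    exact hGb.trans (mul_le_mul hmax hw₃ (NegSup.wInvSup (levWeight (L : ℝ) η lev₀ 3)).coe_nonneg (by positivity))
  have hHb' : ‖H1LatticeCLM (L := (L : ℝ)) (η := η) (lev₀ := lev₀) (levB := levB) φ hposπ hQ lev₁ (nabla115 η U)‖ ≤ CG := by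
    rw [hCGdef]
    exact hHb.trans (mul_le_mul hmax hwB (NegSup.wInvSup (levWeight (L : ℝ) η levB 0)).coe_nonneg (by positivity))
  have hHpt : ∀ Bf : NegSize (L : ℝ) η levB 0 𝔸,
      ‖H1LatticeCLM (L := (L : ℝ)) (η := η) (lev₀ := lev₀) (levB := levB) φ hposπ hQ lev₁ (nabla115 η U) Bf‖ ≤ CG * ‖Bf‖ :=
    fun Bf => (ContinuousLinearMap.le_opNorm _ Bf).trans (mul_le_mul_of_nonneg_right hHb' (norm_nonneg Bf))
  have hGpt : ∀ f : NegSize (L : ℝ) η lev₀ 3 𝔸,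
      ‖frakGLatticeCLM (L := (L : ℝ)) (η := η) (lev₀ := lev₀) φ hposπ hQ lev₁ (nabla115 η U) f‖ ≤ CG * ‖f‖ :=
    fun f => (ContinuousLinearMap.le_opNorm _ f).trans (mul_le_mul_of_nonneg_right hGb' (norm_nonneg f))
  -- `C_k`'s numerics and the composition, verbatim the host
  have hCk := quadAnalytic_Cck L m η (n + 1) U lev₀ lev₁ (nabla115 η U) levB hL2 hG hUG hα₀ hα3 hα4 h52 hlev hρ hρc
  have hCa := analyticOnNhd_Cck L m η (n + 1) U lev₀ lev₁ (nabla115 η U) levB hL2 hG hUG hα₀ hα3 hα4 h52 hlev hρ hρc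
  obtain ⟨R, RC, hRb⟩ := Hreg (frakGLatticeCLM (L := (L : ℝ)) (η := η) (lev₀ := lev₀) φ hposπ hQ lev₁ (nabla115 η U)) Wq
    (H1LatticeCLM (L := (L : ℝ)) (η := η) (lev₀ := lev₀) (levB := levB) φ hposπ hQ lev₁ (nabla115 η U)) (Cck L m η (n + 1) U lev₀ lev₁ (nabla115 η U) levB)
    (H1LatticeCLM (L := (L : ℝ)) (η := η) (lev₀ := lev₀) (levB := levB) φ hposπ hQ lev₁ (nabla115 η U)) hGpt hW hHpt hCk hHpt
  exact chartHB_triple_of_twoRegimes R hWa hj.le ha'' RC hCa hcap _ hRb hR'0 hR'le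

end Summit.QuantumFields.BalabanUV.T4Continuum.NE9CurChartTowerPiLatticeUniform

end
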